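import Summits.NavierStokesRegularity.NavierStokesRegularity.Theorems.TypeITraceScarL3.Negative.StubLOUDFalseWithoutNS
import Literature.Analysis.FluidPDE.VorticityCalculus
import HarnessLib

/-!
# The travelling swirl, part 5: the two NEW stubs Q1 / Q234 of skeleton v4 (`annulus-dichotomy`,
# sha16 3f7a14107033987a) minus their Navier–Stokes clause have kinematic counter-models

Negative-lane lemma file of the disprover seat `cdisprove-stmt-NavierStokesRegularity-18385`
(`--supports` the item).  Skeleton v4 of line `annulus-dichotomy` (nsreg-p2, ROUND-26) splits the
quiet-shell exclusion QA into Q1 `stub_centreEnstrophyAtDepth` («a SINGULAR extinct Type-I apex carries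
centre enstrophy `≥ κ₀T₁^{-1/2}` in `B(0,√T₁)` on an epoch at every scale») and Q234
`stub_quietShell_noConcentration` («a QUIET shell of ratio `A₀` forbids such concentration»).  Census of
the Navier–Stokes clause (sw) for both, kernel-checked, with the divergence-free travelling swirl of parts
1–4:
* `stub_centreEnstrophyAtDepth_false_without_NS` — Q1 minus (sw) is FALSE: along the LOUD path
  (`‖c(t)‖ ≥ 4√(−t)`) the swirl is singular at the origin yet its vorticity VANISHES identically on
  `B(0, √T₁)` for all `t ≤ −T₁/4` (the support `B(c(t), 2√(−t))` misses that ball), so the centre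
  enstrophy is `0 < κ₀T₁^{-1/2}` on every epoch — singularity alone does not force enstrophy at depth
  under the apex; Q1 is genuinely dynamical (compactness + persistence of singularities + unique
  continuation, as its docstring says).
* `stub_quietShell_noConcentration_false_without_NS` — Q234 minus (sw) is FALSE: the STATIC swirl
  (`c ≡ 0`) is quiet on a shell of every ratio, and on `B(0,√T₁)`, `−t ∈ [T₁, 3T₁/2]`, it is the rigid
  rotation `Jx/(2(−t))` with vorticity `(−t)⁻¹e₂`, so its centre enstrophy is
  `≥ (4/9)|B₁|·T₁^{-1/2}` at every scale (take `κ₀ = (4/9)|B₁|`, `c₂ = 1/4`, `t₁ = −T₁`); the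
  continuous representative `V` of the conclusion equals `U` on the open slab.  Q234 is genuinely the
  Carleman statement (Tao 2019 §4–§5) — any proof must use the equations.
Not Navier–Stokes solutions; NS regularity is neither proved nor refuted here.
[folklore; AlbrittonBarker2019 §1; Tao2019 §5]
-/

noncomputable section

set_option linter.dupNamespace false

namespace Summit.NavierStokesRegularity.NavierStokesRegularity.Theorems.TypeITraceScarL3.Negative

open MeasureTheory Set Function Filter Topology Metric TopologicalSpace
open Literature.Analysis.FluidPDE Literature.Analysis.FluidPDE.ParabolicBump
open scoped NNReal ENNReal InnerProductSpace RealInnerProductSpace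

/-! ### Vorticity of the travelling swirl: zero off the support, `(−t)⁻¹e₂` in the core -/

/-- Off `B(c(t), 2√(−t))` the vorticity of the travelling swirl vanishes. [folklore] -/
theorem curl_swirlTravel_eq_zero_of (c : ℝ → EuclideanSpace ℝ (Fin 3)) {t : ℝ} (ht : t < 0)
    {x : EuclideanSpace ℝ (Fin 3)} (hx : 2 * Real.sqrt (-t) ≤ ‖x - c t‖) :
    curl (swirlTravel c t) x = 0 :=
  curl_eq_zero_of_fderiv_eq_zero (by
    rw [fderiv_swirlTravel]
    exact swirlGradient_eq_zero_of ht hx)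

/-- If `‖c(t)‖ ≥ 4√(−t)` and `‖x‖ ≤ 2√(−t)`, the vorticity vanishes at `x`. [folklore] -/
theorem curl_swirlTravel_eq_zero_of_far (c : ℝ → EuclideanSpace ℝ (Fin 3)) {t : ℝ} (ht : t < 0)
    (hc : 4 * Real.sqrt (-t) ≤ ‖c t‖) {x : EuclideanSpace ℝ (Fin 3)}
    (hx : ‖x‖ ≤ 2 * Real.sqrt (-t)) : curl (swirlTravel c t) x = 0 := by
  refine curl_swirlTravel_eq_zero_of c ht ?_
  have h1 : ‖c t‖ ≤ ‖x - c t‖ + ‖x‖ := by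
    calc ‖c t‖ = ‖x - (x - c t)‖ := by rw [sub_sub_cancel]
      _ ≤ ‖x‖ + ‖x - c t‖ := norm_sub_le _ _
      _ = ‖x - c t‖ + ‖x‖ := add_comm _ _
  linarith

/-- In the core `‖x‖² < −t` the amplitude derivative vanishes (`χ' = 0` below `1`). [folklore] -/
theorem swirlAmpDeriv_eq_zero_of_core {t : ℝ} (ht : t < 0) {x : EuclideanSpace ℝ (Fin 3)}
    (hx : ‖x‖ ^ 2 < -t) : swirlAmpDeriv t x = 0 := by
  have hnt : 0 < -t := by linarith
  have h1 : ‖x‖ ^ 2 * (-t)⁻¹ < 1 := by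
    rw [← div_eq_mul_inv, div_lt_one hnt]; exact hx
  have hd : deriv ParabolicBump.cutoff (‖x‖ ^ 2 * (-t)⁻¹) = 0 :=
    ParabolicBump.deriv_cutoff_eq_zero_of_lt (Or.inl h1)
  rw [swirlAmpDeriv, hd, zero_smul, smul_zero]

/-- In the core the Jacobian of the swirl is `(2(−t))⁻¹ J`. [folklore] -/
theorem fderiv_swirlVelocity_core {t : ℝ} (ht : t < 0) {x : EuclideanSpace ℝ (Fin 3)}
    (hx : ‖x‖ ^ 2 < -t) : fderiv ℝ (swirlVelocity t) x = (1 / (2 * (-t))) • rotGenL := by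
  rw [fderiv_swirlVelocity, swirlGradient, swirlAmpDeriv_eq_zero_of_core ht hx,
    swirlAmp_eq_of ht hx.le]
  have : (0 : EuclideanSpace ℝ (Fin 3) →L[ℝ] ℝ).smulRight (rotGen x) = 0 := by
    ext v i; simp
  rw [this, add_zero]

/-- **Core vorticity**: `(curl S(t,·))(x)·e₂ = (−t)⁻¹` for `‖x‖² < −t`. [folklore] -/
theorem curl_swirlVelocity_core_apply_two {t : ℝ} (ht : t < 0) {x : EuclideanSpace ℝ (Fin 3)}
    (hx : ‖x‖ ^ 2 < -t) : curl (swirlVelocity t) x 2 = (-t)⁻¹ := by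
  have hD := fderiv_swirlVelocity_core ht hx
  simp [curl, hD, rotGen]
  ring

/-- Hence `‖curl S(t,·)(x)‖² ≥ (−t)⁻²` in the core. [folklore] -/
theorem inv_sq_le_norm_curl_swirlVelocity_sq {t : ℝ} (ht : t < 0) {x : EuclideanSpace ℝ (Fin 3)}
    (hx : ‖x‖ ^ 2 < -t) : ((-t)⁻¹) ^ 2 ≤ ‖curl (swirlVelocity t) x‖ ^ 2 := by
  have h1 : |curl (swirlVelocity t) x 2| ≤ ‖curl (swirlVelocity t) x‖ := by
    simpa [Real.norm_eq_abs] using PiLp.norm_apply_le (curl (swirlVelocity t) x) 2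
  rw [curl_swirlVelocity_core_apply_two ht hx] at h1
  calc ((-t)⁻¹) ^ 2 = |(-t)⁻¹| ^ 2 := (sq_abs _).symm
    _ ≤ ‖curl (swirlVelocity t) x‖ ^ 2 := pow_le_pow_left₀ (abs_nonneg _) h1 2

/-- The static swirl is the travelling swirl along the constant path `0`. [folklore] -/
theorem swirlTravel_zero_eq : swirlTravel (fun _ => (0 : EuclideanSpace ℝ (Fin 3))) = swirlVelocity := by
  funext t x; simp [swirlTravel]

/-- The vorticity of a smooth-sliced field is continuous. [folklore] -/
theorem continuous_curl_swirlTravel (c : ℝ → EuclideanSpace ℝ (Fin 3)) (t : ℝ) :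
    Continuous (curl (swirlTravel c t)) := by
  rw [curl_eq_curlCLM_comp]
  exact curlCLM.continuous.comp
    ((contDiff_swirlTravel_slice (n := 1) c t).continuous_fderiv one_ne_zero)

/-! ### Continuous representatives on an open slab are the field itself -/

/-- A continuous representative `V` of the travelling swirl on an open slab `]a,b[ × ℝ³`, `b ≤ 0`,
coincides with it slice by slice. [folklore] -/
theorem repr_eq_swirlTravel {c : ℝ → EuclideanSpace ℝ (Fin 3)} (hc : ContDiffOn ℝ 0 c (Iio 0))
    {a b : ℝ} (hb : b ≤ 0) {V : ℝ → EuclideanSpace ℝ (Fin 3) → EuclideanSpace ℝ (Fin 3)}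
    (hae : uncurry V =ᵐ[volume.restrict (Ioo a b ×ˢ (univ : Set (EuclideanSpace ℝ (Fin 3))))]
      uncurry (swirlTravel c))
    (hV : ContinuousOn (uncurry V) (Ioo a b ×ˢ (univ : Set (EuclideanSpace ℝ (Fin 3))))) :
    ∀ t ∈ Ioo a b, V t = swirlTravel c t := by
  have hO : IsOpen (Ioo a b ×ˢ (univ : Set (EuclideanSpace ℝ (Fin 3)))) := isOpen_Ioo.prod isOpen_univ
  have hsub : Ioo a b ×ˢ (univ : Set (EuclideanSpace ℝ (Fin 3))) ⊆ Iio 0 ×ˢ univ :=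
    prod_mono (fun s hs => lt_of_lt_of_le hs.2 hb) Subset.rfl
  have hU : ContinuousOn (uncurry (swirlTravel c)) (Ioo a b ×ˢ (univ : Set (EuclideanSpace ℝ (Fin 3)))) :=
    (contDiffOn_swirlTravel (n := 0) hc).continuousOn.mono hsub
  have heq : EqOn (uncurry V) (uncurry (swirlTravel c)) (Ioo a b ×ˢ (univ : Set (EuclideanSpace ℝ (Fin 3)))) :=
    Measure.eqOn_of_ae_eq hae hV hU (by rw [hO.interior_eq]; exact subset_closure)
  intro t ht
  funext x
  exact heq (show (t, x) ∈ Ioo a b ×ˢ (univ : Set (EuclideanSpace ℝ (Fin 3))) from ⟨ht, mem_univ _⟩)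

/-! ### Q1 minus (sw): a singular apex with NO centre enstrophy at depth -/

/-- **Census for Q1 `stub_centreEnstrophyAtDepth` (skeleton v4): the Navier–Stokes clause is load-bearing
OUTRIGHT (kernel-checked).**  With (sw) deleted the stub is FALSE: the loud travelling swirl (part 4) passes
(G), (I), (D), (R), (T), IS backward singular at the origin, is its own continuous `C¹`-sliced
representative on every depth slab, and its vorticity vanishes identically on `B(0, √T₁)` for
`t ≤ −T₁/4` (the path stays at distance `≥ 4√(−t)`); at scale `T₁ = 1` the claimed lower bound
`κ₀ ≤ ∫_{B(0,1)} ‖curl V(t₁)‖² = 0` fails for every `κ₀ > 0`.  Not NS; NS regularity neither proved nor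
refuted. [folklore; frame of AlbrittonBarker2019 §1] -/
theorem stub_centreEnstrophyAtDepth_false_without_NS :
    ¬ (∀ (M D₀ : ℝ≥0) (C : ℝ), ∃ κ₀ : ℝ, 0 < κ₀ ∧ ∃ c₂ : ℝ, 0 < c₂ ∧ c₂ < 1 / 2 ∧
      ∀ (U : ℝ → EuclideanSpace ℝ (Fin 3) → EuclideanSpace ℝ (Fin 3))
        (P : ℝ → EuclideanSpace ℝ (Fin 3) → ℝ)
        (G : ℝ → EuclideanSpace ℝ (Fin 3) →
          EuclideanSpace ℝ (Fin 3) →L[ℝ] EuclideanSpace ℝ (Fin 3)),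
        (∀ a : ℝ, 0 < a →
          HasWeakSpatialGradientOn
            (parabolicCylinderOpens a (0 : ℝ × EuclideanSpace ℝ (Fin 3))) U G) →
        (∀ a : ℝ, 0 < a →
          typeIBound (parabolicCylinder a (0 : ℝ × EuclideanSpace ℝ (Fin 3))) U P G ≤ M) →
        (∀ z₀ : ℝ × EuclideanSpace ℝ (Fin 3), z₀.1 ≤ 0 →
          ∀ r : ℝ, 0 < r → cknD r z₀ P ≤ D₀) →
        (∀ s : ℝ, s < 0 →
          ∀ᵐ y : EuclideanSpace ℝ (Fin 3), ‖U s y‖ ≤ C / Real.sqrt (-s)) →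
        (∀ φ : EuclideanSpace ℝ (Fin 3) → EuclideanSpace ℝ (Fin 3),
          ContDiff ℝ (⊤ : ℕ∞) φ →
          HasCompactSupport φ → ∀ ε : ℝ, 0 < ε →
          ∃ s₀ : ℝ, s₀ < 0 ∧ ∀ᵐ s ∂(volume.restrict (Ioo s₀ 0)), |∫ y, ⟪U s y, φ y⟫| ≤ ε) →
        IsBackwardSingularPoint U (0 : ℝ × EuclideanSpace ℝ (Fin 3)) →
        (∀ T₁ : ℝ, 0 < T₁ → ∃ t₁ ∈ Icc (-T₁) (-T₁ / 2),
          ∀ V : ℝ → EuclideanSpace ℝ (Fin 3) → EuclideanSpace ℝ (Fin 3),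
            Function.uncurry V =ᵐ[volume.restrict
                (Ioo (-2 * T₁) (-T₁ / 4) ×ˢ (univ : Set (EuclideanSpace ℝ (Fin 3))))]
              Function.uncurry U →
            ContinuousOn (Function.uncurry V)
              (Ioo (-2 * T₁) (-T₁ / 4) ×ˢ (univ : Set (EuclideanSpace ℝ (Fin 3)))) →
            (∀ t ∈ Ioo (-2 * T₁) (-T₁ / 4), ContDiff ℝ 1 (V t)) →
            ∀ t ∈ Icc (t₁ - c₂ * T₁) t₁,
              κ₀ * T₁ ^ (-(1 / 2 : ℝ)) ≤
                ∫ x in ball (0 : EuclideanSpace ℝ (Fin 3)) (Real.sqrt T₁), ‖curl (V t) x‖ ^ 2)) := by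
  intro h
  obtain ⟨M, hM⟩ := typeIBound_swirlTravel_cylinder_le (contDiffOn_loudPath (n := 1))
  obtain ⟨κ₀, hκ₀, c₂, hc₂, -, h'⟩ := h M 0 1
  obtain ⟨t₁, ht₁, hV⟩ := h' (swirlTravel loudPath) 0 (swirlTravelGradient loudPath)
    (fun a _ => swirlTravel_hasWeakSpatialGradientOn (contDiffOn_loudPath (n := 1)) a)
    (fun a _ => hM a) (fun z₀ _ r _ => (cknD_zero r z₀).le) (swirlTravel_rate loudPath)
    (swirlTravel_nullTop loudPath) swirlLoud_isBackwardSingularPoint 1 one_pos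
  have hslab : Ioo (-2 * (1 : ℝ)) (-1 / 4) ×ˢ (univ : Set (EuclideanSpace ℝ (Fin 3))) ⊆ Iio 0 ×ˢ univ :=
    prod_mono (fun s hs => show s < 0 by linarith [hs.2]) Subset.rfl
  have hcont : ContinuousOn (Function.uncurry (swirlTravel loudPath))
      (Ioo (-2 * (1 : ℝ)) (-1 / 4) ×ˢ (univ : Set (EuclideanSpace ℝ (Fin 3)))) :=
    (contDiffOn_swirlTravel (n := 0) (contDiffOn_loudPath (n := 0))).continuousOn.mono hslab
  have hbound := hV (swirlTravel loudPath) EventuallyEq.rfl hcont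
    (fun t _ => contDiff_swirlTravel_slice (n := 1) loudPath t) t₁
    ⟨by nlinarith [hc₂, ht₁.1], le_rfl⟩
  have ht1neg : t₁ < 0 := by linarith [ht₁.2]
  have hzero : ∫ x in ball (0 : EuclideanSpace ℝ (Fin 3)) (Real.sqrt 1),
      ‖curl (swirlTravel loudPath t₁) x‖ ^ 2 = 0 := by
    refine setIntegral_eq_zero_of_forall_eq_zero fun x hx => ?_
    rw [Real.sqrt_one, mem_ball, dist_zero_right] at hx
    have hs : 1 / 2 ≤ Real.sqrt (-t₁) := by
      rw [show (1 / 2 : ℝ) = Real.sqrt ((1 / 2) ^ 2) by rw [Real.sqrt_sq (by norm_num)]]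
      exact Real.sqrt_le_sqrt (by nlinarith [ht₁.2])
    rw [curl_swirlTravel_eq_zero_of_far loudPath ht1neg
      (by rw [norm_loudPath]; exact four_sqrt_le_loudRadius ht1neg) (by linarith), norm_zero,
      zero_pow two_ne_zero]
  rw [hzero, Real.one_rpow, mul_one] at hbound
  exact absurd hbound (not_le.2 hκ₀)

/-! ### Q234 minus (sw): a quiet apex WITH centre enstrophy concentration at every scale -/

/-- The static swirl is quiet on the shell `]−1/16, 0[ × {1 < ‖y‖ < A}` (it vanishes there). [folklore] -/
theorem swirlStatic_quietShell (A : ℝ) :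
    ∀ᵐ z ∂(volume.restrict
      (Ioo (-(1 / 16 : ℝ)) 0 ×ˢ {y : EuclideanSpace ℝ (Fin 3) | 1 < ‖y‖ ∧ ‖y‖ < A})),
        ‖swirlTravel (fun _ => (0 : EuclideanSpace ℝ (Fin 3))) z.1 z.2‖ ≤ 0 := by
  refine (ae_restrict_iff' (measurableSet_Ioo.prod (isOpen_shell 1 A).measurableSet)).2
    (Eventually.of_forall fun z hz => ?_)
  have ht : z.1 < 0 := hz.1.2
  have hσ : Real.sqrt (-z.1) < 1 / 4 := by
    rw [show (1 / 4 : ℝ) = Real.sqrt ((1 / 4) ^ 2) by rw [Real.sqrt_sq (by norm_num)]]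
    exact Real.sqrt_lt_sqrt (by linarith) (by nlinarith [hz.1.1])
  rw [swirlTravel_eq_zero_of _ ht (by rw [sub_zero]; linarith [hz.2.1]), norm_zero]

/-- **Centre enstrophy of the static swirl**: for `T₁ > 0` and `−t ∈ [T₁, 3T₁/2]`,
`∫_{B(0,√T₁)} ‖curl S(t,·)‖² ≥ (4/9)|B₁| T₁^{-1/2}`. [folklore] -/
theorem centreEnstrophy_swirlStatic_ge {T₁ t : ℝ} (hT : 0 < T₁) (ht1 : T₁ ≤ -t) (ht2 : -t ≤ 3 / 2 * T₁) :
    4 / 9 * (volume (ball (0 : EuclideanSpace ℝ (Fin 3)) 1)).toReal * T₁ ^ (-(1 / 2 : ℝ)) ≤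
      ∫ x in ball (0 : EuclideanSpace ℝ (Fin 3)) (Real.sqrt T₁), ‖curl (swirlVelocity t) x‖ ^ 2 := by
  have ht : t < 0 := by linarith
  have hnt : 0 < -t := by linarith
  have hsq : 0 < Real.sqrt T₁ := Real.sqrt_pos.2 hT
  set V₁r : ℝ := (volume (ball (0 : EuclideanSpace ℝ (Fin 3)) 1)).toReal with hV₁r
  have hV0 : 0 ≤ V₁r := ENNReal.toReal_nonneg
  -- integrability of the continuous integrand on the ball
  have hcont : Continuous fun x => ‖curl (swirlVelocity t) x‖ ^ 2 := by
    rw [← swirlTravel_zero_eq]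
    exact ((continuous_curl_swirlTravel _ t).norm).pow 2
  have hint : IntegrableOn (fun x => ‖curl (swirlVelocity t) x‖ ^ 2)
      (ball (0 : EuclideanSpace ℝ (Fin 3)) (Real.sqrt T₁)) volume :=
    (hcont.continuousOn.integrableOn_compact (isCompact_closedBall 0 (Real.sqrt T₁))).mono_set
      ball_subset_closedBall
  -- pointwise lower bound in the core (the whole ball lies in the core since `T₁ ≤ −t`)
  have hcore : ∀ x ∈ ball (0 : EuclideanSpace ℝ (Fin 3)) (Real.sqrt T₁),
      ((-t)⁻¹) ^ 2 ≤ ‖curl (swirlVelocity t) x‖ ^ 2 := by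
    intro x hx
    rw [mem_ball, dist_zero_right] at hx
    refine inv_sq_le_norm_curl_swirlVelocity_sq ht ?_
    have h1 : ‖x‖ ^ 2 < Real.sqrt T₁ ^ 2 := by
      exact pow_lt_pow_left₀ hx (norm_nonneg _) two_ne_zero
    rw [Real.sq_sqrt hT.le] at h1
    linarith
  have hlow : ∫ x in ball (0 : EuclideanSpace ℝ (Fin 3)) (Real.sqrt T₁), ((-t)⁻¹) ^ 2 ≤
      ∫ x in ball (0 : EuclideanSpace ℝ (Fin 3)) (Real.sqrt T₁), ‖curl (swirlVelocity t) x‖ ^ 2 :=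
    setIntegral_mono_on (integrableOn_const (hs := measure_ball_lt_top.ne)) hint measurableSet_ball hcore
  rw [setIntegral_const, smul_eq_mul, measureReal_def, volume_ball_toReal 0 hsq, ← hV₁r] at hlow
  refine le_trans ?_ hlow
  -- `(4/9) V₁ T₁^{-1/2} ≤ √T₁³ V₁ (−t)⁻²`
  have hs3 : Real.sqrt T₁ ^ 3 = T₁ * Real.sqrt T₁ := by
    rw [pow_succ, Real.sq_sqrt hT.le]
  have hrpow : T₁ ^ (-(1 / 2 : ℝ)) = (Real.sqrt T₁)⁻¹ := by
    rw [Real.rpow_neg hT.le, ← Real.sqrt_eq_rpow]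
  rw [hs3, hrpow]
  have hkey : 4 / 9 * (Real.sqrt T₁)⁻¹ ≤ T₁ * Real.sqrt T₁ * ((-t)⁻¹) ^ 2 := by
    have h32 : (-t) ^ 2 ≤ (3 / 2 * T₁) ^ 2 := pow_le_pow_left₀ hnt.le ht2 2
    have hS : (Real.sqrt T₁)⁻¹ * T₁ = Real.sqrt T₁ := by
      rw [inv_mul_eq_iff_eq_mul₀ hsq.ne', ← pow_two, Real.sq_sqrt hT.le]
    have e1 : T₁ * Real.sqrt T₁ * ((-t)⁻¹) ^ 2 = T₁ * Real.sqrt T₁ / (-t) ^ 2 := by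
      rw [inv_pow, div_eq_mul_inv]
    rw [e1, le_div_iff₀ (by positivity)]
    calc 4 / 9 * (Real.sqrt T₁)⁻¹ * (-t) ^ 2 ≤ 4 / 9 * (Real.sqrt T₁)⁻¹ * (3 / 2 * T₁) ^ 2 := by
          gcongr
      _ = T₁ * ((Real.sqrt T₁)⁻¹ * T₁) := by ring
      _ = T₁ * Real.sqrt T₁ := by rw [hS]
  calc 4 / 9 * V₁r * (Real.sqrt T₁)⁻¹ = V₁r * (4 / 9 * (Real.sqrt T₁)⁻¹) := by ring
    _ ≤ V₁r * (T₁ * Real.sqrt T₁ * ((-t)⁻¹) ^ 2) := mul_le_mul_of_nonneg_left hkey hV0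
    _ = T₁ * Real.sqrt T₁ * V₁r * ((-t)⁻¹) ^ 2 := by ring

/-- **Census for Q234 `stub_quietShell_noConcentration` (skeleton v4): the Navier–Stokes clause is
load-bearing OUTRIGHT (kernel-checked).**  With (sw) deleted the stub is FALSE at the class of the static
swirl with `κ₀ = (4/9)|B₁|`, `c₂ = 1/4`: for EVERY ratio `A₀ > 1` the static swirl passes (G), (I), (D),
(R), (T), is QUIET on `]−1/16,0[ × {1 < ‖y‖ < A₀}`, and yet carries centre enstrophy
`≥ κ₀T₁^{-1/2}` on `B(0,√T₁)` throughout `[−5T₁/4, −T₁]` at every scale `T₁` (its continuous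
representatives on the depth slab coincide with it).  So Q234 is genuinely the Carleman statement: any
proof must use the equations.  Not NS; NS regularity neither proved nor refuted.
[folklore; Tao2019 §5; frame of AlbrittonBarker2019 §1] -/
theorem stub_quietShell_noConcentration_false_without_NS :
    ¬ (∀ (M D₀ : ℝ≥0) (C κ₀ c₂ : ℝ), 0 < κ₀ → 0 < c₂ → c₂ < 1 / 2 → ∃ A₀ : ℝ, 1 < A₀ ∧
      ∀ (U : ℝ → EuclideanSpace ℝ (Fin 3) → EuclideanSpace ℝ (Fin 3))
        (P : ℝ → EuclideanSpace ℝ (Fin 3) → ℝ)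
        (G : ℝ → EuclideanSpace ℝ (Fin 3) →
          EuclideanSpace ℝ (Fin 3) →L[ℝ] EuclideanSpace ℝ (Fin 3)),
        (∀ a : ℝ, 0 < a →
          HasWeakSpatialGradientOn
            (parabolicCylinderOpens a (0 : ℝ × EuclideanSpace ℝ (Fin 3))) U G) →
        (∀ a : ℝ, 0 < a →
          typeIBound (parabolicCylinder a (0 : ℝ × EuclideanSpace ℝ (Fin 3))) U P G ≤ M) →
        (∀ z₀ : ℝ × EuclideanSpace ℝ (Fin 3), z₀.1 ≤ 0 →
          ∀ r : ℝ, 0 < r → cknD r z₀ P ≤ D₀) →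
        (∀ s : ℝ, s < 0 →
          ∀ᵐ y : EuclideanSpace ℝ (Fin 3), ‖U s y‖ ≤ C / Real.sqrt (-s)) →
        (∀ φ : EuclideanSpace ℝ (Fin 3) → EuclideanSpace ℝ (Fin 3),
          ContDiff ℝ (⊤ : ℕ∞) φ →
          HasCompactSupport φ → ∀ ε : ℝ, 0 < ε →
          ∃ s₀ : ℝ, s₀ < 0 ∧ ∀ᵐ s ∂(volume.restrict (Ioo s₀ 0)), |∫ y, ⟪U s y, φ y⟫| ≤ ε) →
        (∃ δ : ℝ, 0 < δ ∧ ∃ R : ℝ, 0 < R ∧ ∃ K : ℝ,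
          ∀ᵐ z ∂(volume.restrict
            (Ioo (-δ) 0 ×ˢ {y : EuclideanSpace ℝ (Fin 3) | R < ‖y‖ ∧ ‖y‖ < A₀ * R})),
              ‖U z.1 z.2‖ ≤ K) →
        ¬ (∀ T₁ : ℝ, 0 < T₁ → ∃ t₁ ∈ Icc (-T₁) (-T₁ / 2),
          ∀ V : ℝ → EuclideanSpace ℝ (Fin 3) → EuclideanSpace ℝ (Fin 3),
            Function.uncurry V =ᵐ[volume.restrict
                (Ioo (-2 * T₁) (-T₁ / 4) ×ˢ (univ : Set (EuclideanSpace ℝ (Fin 3))))]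
              Function.uncurry U →
            ContinuousOn (Function.uncurry V)
              (Ioo (-2 * T₁) (-T₁ / 4) ×ˢ (univ : Set (EuclideanSpace ℝ (Fin 3)))) →
            (∀ t ∈ Ioo (-2 * T₁) (-T₁ / 4), ContDiff ℝ 1 (V t)) →
            ∀ t ∈ Icc (t₁ - c₂ * T₁) t₁,
              κ₀ * T₁ ^ (-(1 / 2 : ℝ)) ≤
                ∫ x in ball (0 : EuclideanSpace ℝ (Fin 3)) (Real.sqrt T₁), ‖curl (V t) x‖ ^ 2)) := by
  intro h
  set c0 : ℝ → EuclideanSpace ℝ (Fin 3) := fun _ => 0 with hc0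
  have hc1 : ContDiffOn ℝ 1 c0 (Iio 0) := contDiffOn_const
  have hc00 : ContDiffOn ℝ 0 c0 (Iio 0) := contDiffOn_const
  obtain ⟨M, hM⟩ := typeIBound_swirlTravel_cylinder_le hc1
  set V₁r : ℝ := (volume (ball (0 : EuclideanSpace ℝ (Fin 3)) 1)).toReal with hV₁r
  have hV₁pos : 0 < V₁r := by
    rw [hV₁r]
    exact ENNReal.toReal_pos (measure_ball_pos volume 0 one_pos).ne' measure_ball_lt_top.ne
  have hκ : 0 < 4 / 9 * V₁r := by positivity
  obtain ⟨A₀, -, hA⟩ := h M 0 1 (4 / 9 * V₁r) (1 / 4) hκ (by norm_num) (by norm_num)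
  refine hA (swirlTravel c0) 0 (swirlTravelGradient c0)
    (fun a _ => swirlTravel_hasWeakSpatialGradientOn hc1 a) (fun a _ => hM a)
    (fun z₀ _ r _ => (cknD_zero r z₀).le) (swirlTravel_rate c0) (swirlTravel_nullTop c0)
    ⟨1 / 16, by norm_num, 1, one_pos, 0, by
      simpa only [mul_one] using swirlStatic_quietShell A₀⟩ ?_
  intro T₁ hT₁
  refine ⟨-T₁, ⟨le_rfl, by linarith⟩, fun V hae hV _ t ht => ?_⟩
  have htslab : t ∈ Ioo (-2 * T₁) (-T₁ / 4) := ⟨by linarith [ht.1], by linarith [ht.2]⟩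
  rw [repr_eq_swirlTravel hc00 (by linarith) hae hV t htslab, swirlTravel_zero_eq]
  exact centreEnstrophy_swirlStatic_ge hT₁ (by linarith [ht.2]) (by linarith [ht.1])

end Summit.NavierStokesRegularity.NavierStokesRegularity.Theorems.TypeITraceScarL3.Negative

end
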